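import Mathlib.Tactic.Ring
import Mathlib.Tactic.Linarith
import Mathlib.Tactic.Positivity
import Mathlib.Tactic.LinearCombination
import Mathlib.Data.Real.Basic
import Summits.HodgeConjecture.HodgeConjecture.Theorems.WeilClassTestFormatFiveThreeDoublyOneSidedAllTilts
import HarnessLib

/-!
# Conjecture N (hodge-weil ladder, GAPS G51b/G51c), format (5,3): THE CHARGE-PATTERN SIGN LAW (twelve excluded patterns)

Prover 2, generation 16 (note `run/shared/lean/b2b/hodge-weil/b2b-hweil-pv2-g16/DOS-G16.md` ADDENDUM). Setting of `CONJECTURE-N.md` §1 in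
format (5,3). Centring + (P4) say that the Leibniz second divided difference `DD2` of `g ↦ ∏_e(u_e − v_g)` over the three F-charges vanishes
(`WeilClassTestFormatFiveThreeDoublyOneSidedAllTilts.dd2_of_pure`). With the E-charges taken in increasing order, `DD2` is a sum of ten products
of three charge differences `(u₁−v₁), (u₂−v₁), (u₃−v₁), (u₂−v₂), (u₃−v₂), (u₄−v₂), (u₃−v₃), (u₄−v₃), (u₅−v₃)`; for twelve of the 56 charge
patterns `(n₁ ≤ n₂ ≤ n₃)` (`n_g` = number of E-charges below `v_g`) all ten products have the same strict sign, so no centred configuration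
satisfying (P4) realises the pattern with strict inequalities: `(0,0,0) FFFEEEEE`, `(0,0,1) FFEFEEEE`, `(0,0,2) FFEEFEEE`, `(0,1,1) FEFFEEEE`,
`(0,1,2) FEFEFEEE`, `(1,2,3) EFEFEFEE`, `(2,3,4) EEFEFEFE`, `(3,4,5) EEEFEFEF`, `(3,5,5) EEEFEEFF`, `(4,4,5) EEEEFFEF`, `(4,5,5) EEEEFEFF`,
`(5,5,5) EEEEEFFF` (the format-(5,3) analogue of pv2-g12/g13's sign law and of pv2-g14's `both_below_impossible`; positions and ampleness are
not used). The twelve patterns fall into four sign classes, one theorem each (`signlaw_low`, `signlaw_high`, `signlaw_123`, `signlaw_234`);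
read on sorted charges: `v_g ≥ u_g` for some `g`, `v_g ≤ u_{g+2}` for some `g`, and the two perfect interlacings are excluded. Eight of the
twelve are among the 40 parity-allowed patterns for `Q₄ < 0`; with `conjectureN_53_doublyOneSided` (class (0,5)) this leaves 26 patterns
(13 up to the reflection `u ↦ −u`) for the `Q₄ < 0` half of Conjecture N in format (5,3).
Pure algebra; nothing here is a case of HC, a rung or a door edge; no statement of Markman's papers is used. New cell result ⇒ Summits/.
-/

set_option linter.dupNamespace false

open Summit.HodgeConjecture.HodgeConjecture.WeilClassTestFormatFiveThreeDoublyOneSidedAllTilts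

namespace Summit.HodgeConjecture.HodgeConjecture.WeilClassTestFormatFiveThreeSignLaw

/-- SIGN LAW, all nine factors positive — sorted reading: `n₁ = 0`, `n₂ ≤ 1`, `n₃ ≤ 2`, i.e. the patterns `(0,0,0) FFFEEEEE`, `(0,0,1) FFEFEEEE`, `(0,0,2) FFEEFEEE`, `(0,1,1) FEFFEEEE`, `(0,1,2) FEFEFEEE`: with sorted charges, `v₁ < u₁ ∧ v₂ < u₂ ∧ v₃ < u₃` is impossible; for centred charges satisfying (P4) (positions and ampleness play no role). -/
theorem signlaw_low (u₁ u₂ u₃ u₄ u₅ v₁ v₂ v₃ : ℝ)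
    (hC : u₁ + u₂ + u₃ + u₄ + u₅ = v₁ + v₂ + v₃)
    (hP4 : (u₁ ^ 3 + u₂ ^ 3 + u₃ ^ 3 + u₄ ^ 3 + u₅ ^ 3) - (v₁ ^ 3 + v₂ ^ 3 + v₃ ^ 3) = 0)
    (h₁₁ : v₁ < u₁) (h₂₁ : v₁ < u₂) (h₃₁ : v₁ < u₃) (h₂₂ : v₂ < u₂) (h₃₂ : v₂ < u₃)
    (h₄₂ : v₂ < u₄) (h₃₃ : v₃ < u₃) (h₄₃ : v₃ < u₄) (h₅₃ : v₃ < u₅) : False := by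
  have hdd := dd2_of_pure u₁ u₂ u₃ u₄ u₅ v₁ v₂ v₃ hC hP4
  have t0 : 0 < (u₃ - v₃) * (u₄ - v₃) * (u₅ - v₃) := mul_pos (mul_pos (sub_pos.mpr h₃₃) (sub_pos.mpr h₄₃)) (sub_pos.mpr h₅₃)
  have t1 : 0 < (u₂ - v₂) * (u₄ - v₃) * (u₅ - v₃) := mul_pos (mul_pos (sub_pos.mpr h₂₂) (sub_pos.mpr h₄₃)) (sub_pos.mpr h₅₃)
  have t2 : 0 < (u₂ - v₂) * (u₃ - v₂) * (u₅ - v₃) := mul_pos (mul_pos (sub_pos.mpr h₂₂) (sub_pos.mpr h₃₂)) (sub_pos.mpr h₅₃)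
  have t3 : 0 < (u₂ - v₂) * (u₃ - v₂) * (u₄ - v₂) := mul_pos (mul_pos (sub_pos.mpr h₂₂) (sub_pos.mpr h₃₂)) (sub_pos.mpr h₄₂)
  have t4 : 0 < (u₁ - v₁) * (u₄ - v₃) * (u₅ - v₃) := mul_pos (mul_pos (sub_pos.mpr h₁₁) (sub_pos.mpr h₄₃)) (sub_pos.mpr h₅₃)
  have t5 : 0 < (u₁ - v₁) * (u₃ - v₂) * (u₅ - v₃) := mul_pos (mul_pos (sub_pos.mpr h₁₁) (sub_pos.mpr h₃₂)) (sub_pos.mpr h₅₃)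
  have t6 : 0 < (u₁ - v₁) * (u₃ - v₂) * (u₄ - v₂) := mul_pos (mul_pos (sub_pos.mpr h₁₁) (sub_pos.mpr h₃₂)) (sub_pos.mpr h₄₂)
  have t7 : 0 < (u₁ - v₁) * (u₂ - v₁) * (u₅ - v₃) := mul_pos (mul_pos (sub_pos.mpr h₁₁) (sub_pos.mpr h₂₁)) (sub_pos.mpr h₅₃)
  have t8 : 0 < (u₁ - v₁) * (u₂ - v₁) * (u₄ - v₂) := mul_pos (mul_pos (sub_pos.mpr h₁₁) (sub_pos.mpr h₂₁)) (sub_pos.mpr h₄₂)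
  have t9 : 0 < (u₁ - v₁) * (u₂ - v₁) * (u₃ - v₁) := mul_pos (mul_pos (sub_pos.mpr h₁₁) (sub_pos.mpr h₂₁)) (sub_pos.mpr h₃₁)
  linarith

/-- SIGN LAW, all nine factors negative — sorted reading: `n₁ ≥ 3`, `n₂ ≥ 4`, `n₃ = 5`, i.e. the patterns `(3,4,5) EEEFEFEF`, `(3,5,5) EEEFEEFF`, `(4,4,5) EEEEFFEF`, `(4,5,5) EEEEFEFF`, `(5,5,5) EEEEEFFF` (reflection of `signlaw_low`): `u₃ < v₁ ∧ u₄ < v₂ ∧ u₅ < v₃` is impossible; for centred charges satisfying (P4) (positions and ampleness play no role). -/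
theorem signlaw_high (u₁ u₂ u₃ u₄ u₅ v₁ v₂ v₃ : ℝ)
    (hC : u₁ + u₂ + u₃ + u₄ + u₅ = v₁ + v₂ + v₃)
    (hP4 : (u₁ ^ 3 + u₂ ^ 3 + u₃ ^ 3 + u₄ ^ 3 + u₅ ^ 3) - (v₁ ^ 3 + v₂ ^ 3 + v₃ ^ 3) = 0)
    (h₁₁ : u₁ < v₁) (h₂₁ : u₂ < v₁) (h₃₁ : u₃ < v₁) (h₂₂ : u₂ < v₂) (h₃₂ : u₃ < v₂)
    (h₄₂ : u₄ < v₂) (h₃₃ : u₃ < v₃) (h₄₃ : u₄ < v₃) (h₅₃ : u₅ < v₃) : False := by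
  have hdd := dd2_of_pure u₁ u₂ u₃ u₄ u₅ v₁ v₂ v₃ hC hP4
  have t0 : 0 < (v₃ - u₃) * (v₃ - u₄) * (v₃ - u₅) := mul_pos (mul_pos (sub_pos.mpr h₃₃) (sub_pos.mpr h₄₃)) (sub_pos.mpr h₅₃)
  have t1 : 0 < (v₂ - u₂) * (v₃ - u₄) * (v₃ - u₅) := mul_pos (mul_pos (sub_pos.mpr h₂₂) (sub_pos.mpr h₄₃)) (sub_pos.mpr h₅₃)
  have t2 : 0 < (v₂ - u₂) * (v₂ - u₃) * (v₃ - u₅) := mul_pos (mul_pos (sub_pos.mpr h₂₂) (sub_pos.mpr h₃₂)) (sub_pos.mpr h₅₃)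
  have t3 : 0 < (v₂ - u₂) * (v₂ - u₃) * (v₂ - u₄) := mul_pos (mul_pos (sub_pos.mpr h₂₂) (sub_pos.mpr h₃₂)) (sub_pos.mpr h₄₂)
  have t4 : 0 < (v₁ - u₁) * (v₃ - u₄) * (v₃ - u₅) := mul_pos (mul_pos (sub_pos.mpr h₁₁) (sub_pos.mpr h₄₃)) (sub_pos.mpr h₅₃)
  have t5 : 0 < (v₁ - u₁) * (v₂ - u₃) * (v₃ - u₅) := mul_pos (mul_pos (sub_pos.mpr h₁₁) (sub_pos.mpr h₃₂)) (sub_pos.mpr h₅₃)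
  have t6 : 0 < (v₁ - u₁) * (v₂ - u₃) * (v₂ - u₄) := mul_pos (mul_pos (sub_pos.mpr h₁₁) (sub_pos.mpr h₃₂)) (sub_pos.mpr h₄₂)
  have t7 : 0 < (v₁ - u₁) * (v₁ - u₂) * (v₃ - u₅) := mul_pos (mul_pos (sub_pos.mpr h₁₁) (sub_pos.mpr h₂₁)) (sub_pos.mpr h₅₃)
  have t8 : 0 < (v₁ - u₁) * (v₁ - u₂) * (v₂ - u₄) := mul_pos (mul_pos (sub_pos.mpr h₁₁) (sub_pos.mpr h₂₁)) (sub_pos.mpr h₄₂)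
  have t9 : 0 < (v₁ - u₁) * (v₁ - u₂) * (v₁ - u₃) := mul_pos (mul_pos (sub_pos.mpr h₁₁) (sub_pos.mpr h₂₁)) (sub_pos.mpr h₃₁)
  linarith

/-- SIGN LAW, the interlacing pattern `(1,2,3) EFEFEFEE`: `u₁ < v₁ < u₂ < v₂ < u₃ < v₃ < u₄` (with `u₃ > v₁`, `u₄ > v₂`, `u₅ > v₃`) is impossible; for centred charges satisfying (P4) (positions and ampleness play no role). -/
theorem signlaw_123 (u₁ u₂ u₃ u₄ u₅ v₁ v₂ v₃ : ℝ)
    (hC : u₁ + u₂ + u₃ + u₄ + u₅ = v₁ + v₂ + v₃)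
    (hP4 : (u₁ ^ 3 + u₂ ^ 3 + u₃ ^ 3 + u₄ ^ 3 + u₅ ^ 3) - (v₁ ^ 3 + v₂ ^ 3 + v₃ ^ 3) = 0)
    (h₁₁ : u₁ < v₁) (h₂₁ : v₁ < u₂) (h₃₁ : v₁ < u₃) (h₂₂ : u₂ < v₂) (h₃₂ : v₂ < u₃)
    (h₄₂ : v₂ < u₄) (h₃₃ : u₃ < v₃) (h₄₃ : v₃ < u₄) (h₅₃ : v₃ < u₅) : False := by
  have hdd := dd2_of_pure u₁ u₂ u₃ u₄ u₅ v₁ v₂ v₃ hC hP4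
  have t0 : 0 < (v₃ - u₃) * (u₄ - v₃) * (u₅ - v₃) := mul_pos (mul_pos (sub_pos.mpr h₃₃) (sub_pos.mpr h₄₃)) (sub_pos.mpr h₅₃)
  have t1 : 0 < (v₂ - u₂) * (u₄ - v₃) * (u₅ - v₃) := mul_pos (mul_pos (sub_pos.mpr h₂₂) (sub_pos.mpr h₄₃)) (sub_pos.mpr h₅₃)
  have t2 : 0 < (v₂ - u₂) * (u₃ - v₂) * (u₅ - v₃) := mul_pos (mul_pos (sub_pos.mpr h₂₂) (sub_pos.mpr h₃₂)) (sub_pos.mpr h₅₃)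
  have t3 : 0 < (v₂ - u₂) * (u₃ - v₂) * (u₄ - v₂) := mul_pos (mul_pos (sub_pos.mpr h₂₂) (sub_pos.mpr h₃₂)) (sub_pos.mpr h₄₂)
  have t4 : 0 < (v₁ - u₁) * (u₄ - v₃) * (u₅ - v₃) := mul_pos (mul_pos (sub_pos.mpr h₁₁) (sub_pos.mpr h₄₃)) (sub_pos.mpr h₅₃)
  have t5 : 0 < (v₁ - u₁) * (u₃ - v₂) * (u₅ - v₃) := mul_pos (mul_pos (sub_pos.mpr h₁₁) (sub_pos.mpr h₃₂)) (sub_pos.mpr h₅₃)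
  have t6 : 0 < (v₁ - u₁) * (u₃ - v₂) * (u₄ - v₂) := mul_pos (mul_pos (sub_pos.mpr h₁₁) (sub_pos.mpr h₃₂)) (sub_pos.mpr h₄₂)
  have t7 : 0 < (v₁ - u₁) * (u₂ - v₁) * (u₅ - v₃) := mul_pos (mul_pos (sub_pos.mpr h₁₁) (sub_pos.mpr h₂₁)) (sub_pos.mpr h₅₃)
  have t8 : 0 < (v₁ - u₁) * (u₂ - v₁) * (u₄ - v₂) := mul_pos (mul_pos (sub_pos.mpr h₁₁) (sub_pos.mpr h₂₁)) (sub_pos.mpr h₄₂)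
  have t9 : 0 < (v₁ - u₁) * (u₂ - v₁) * (u₃ - v₁) := mul_pos (mul_pos (sub_pos.mpr h₁₁) (sub_pos.mpr h₂₁)) (sub_pos.mpr h₃₁)
  linarith

/-- SIGN LAW, the interlacing pattern `(2,3,4) EEFEFEFE`: `u₂ < v₁ < u₃ < v₂ < u₄ < v₃ < u₅` (with `u₁ < v₁`, `u₂ < v₂`, `u₃ < v₃`) is impossible; for centred charges satisfying (P4) (positions and ampleness play no role). -/
theorem signlaw_234 (u₁ u₂ u₃ u₄ u₅ v₁ v₂ v₃ : ℝ)
    (hC : u₁ + u₂ + u₃ + u₄ + u₅ = v₁ + v₂ + v₃)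
    (hP4 : (u₁ ^ 3 + u₂ ^ 3 + u₃ ^ 3 + u₄ ^ 3 + u₅ ^ 3) - (v₁ ^ 3 + v₂ ^ 3 + v₃ ^ 3) = 0)
    (h₁₁ : u₁ < v₁) (h₂₁ : u₂ < v₁) (h₃₁ : v₁ < u₃) (h₂₂ : u₂ < v₂) (h₃₂ : u₃ < v₂)
    (h₄₂ : v₂ < u₄) (h₃₃ : u₃ < v₃) (h₄₃ : u₄ < v₃) (h₅₃ : v₃ < u₅) : False := by
  have hdd := dd2_of_pure u₁ u₂ u₃ u₄ u₅ v₁ v₂ v₃ hC hP4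
  have t0 : 0 < (v₃ - u₃) * (v₃ - u₄) * (u₅ - v₃) := mul_pos (mul_pos (sub_pos.mpr h₃₃) (sub_pos.mpr h₄₃)) (sub_pos.mpr h₅₃)
  have t1 : 0 < (v₂ - u₂) * (v₃ - u₄) * (u₅ - v₃) := mul_pos (mul_pos (sub_pos.mpr h₂₂) (sub_pos.mpr h₄₃)) (sub_pos.mpr h₅₃)
  have t2 : 0 < (v₂ - u₂) * (v₂ - u₃) * (u₅ - v₃) := mul_pos (mul_pos (sub_pos.mpr h₂₂) (sub_pos.mpr h₃₂)) (sub_pos.mpr h₅₃)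
  have t3 : 0 < (v₂ - u₂) * (v₂ - u₃) * (u₄ - v₂) := mul_pos (mul_pos (sub_pos.mpr h₂₂) (sub_pos.mpr h₃₂)) (sub_pos.mpr h₄₂)
  have t4 : 0 < (v₁ - u₁) * (v₃ - u₄) * (u₅ - v₃) := mul_pos (mul_pos (sub_pos.mpr h₁₁) (sub_pos.mpr h₄₃)) (sub_pos.mpr h₅₃)
  have t5 : 0 < (v₁ - u₁) * (v₂ - u₃) * (u₅ - v₃) := mul_pos (mul_pos (sub_pos.mpr h₁₁) (sub_pos.mpr h₃₂)) (sub_pos.mpr h₅₃)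
  have t6 : 0 < (v₁ - u₁) * (v₂ - u₃) * (u₄ - v₂) := mul_pos (mul_pos (sub_pos.mpr h₁₁) (sub_pos.mpr h₃₂)) (sub_pos.mpr h₄₂)
  have t7 : 0 < (v₁ - u₁) * (v₁ - u₂) * (u₅ - v₃) := mul_pos (mul_pos (sub_pos.mpr h₁₁) (sub_pos.mpr h₂₁)) (sub_pos.mpr h₅₃)
  have t8 : 0 < (v₁ - u₁) * (v₁ - u₂) * (u₄ - v₂) := mul_pos (mul_pos (sub_pos.mpr h₁₁) (sub_pos.mpr h₂₁)) (sub_pos.mpr h₄₂)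
  have t9 : 0 < (v₁ - u₁) * (v₁ - u₂) * (u₃ - v₁) := mul_pos (mul_pos (sub_pos.mpr h₁₁) (sub_pos.mpr h₂₁)) (sub_pos.mpr h₃₁)
  linarith

end Summit.HodgeConjecture.HodgeConjecture.WeilClassTestFormatFiveThreeSignLaw
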